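import Mathlib.LinearAlgebra.Matrix.Charpoly.Basic
import Mathlib.LinearAlgebra.Matrix.Charpoly.Coeff
import Mathlib.LinearAlgebra.Matrix.GeneralLinearGroup.Defs
import Mathlib.LinearAlgebra.Matrix.ToLinearEquiv
import Mathlib.Algebra.Polynomial.SpecificDegree
import Mathlib.LinearAlgebra.Matrix.Notation
import Mathlib.LinearAlgebra.Matrix.Trace
import Mathlib.Topology.Algebra.InfiniteSum.ENNReal
import Mathlib.GroupTheory.GroupAction.Quotient
import Literature.NumberTheory.Automorphic.ParabolicGL
import HarnessLib

/-!
# The parabolic elements of `GL₂(F)`: conjugation into the Borel subgroup, Bruhat decomposition,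
# and the Borel subgroups containing a given element
(Gelbart, *Automorphic forms on adele groups* (1975), (9.36)–(9.39), p. 126: the decomposition of
`G_ℚ ∖ Z_ℚ` into elliptic elements and conjugates of non-central elements of `B_ℚ`;
Jacquet–Langlands (1970), §16)

Topic `NumberTheory/Automorphic`; theorems only (no definition, no named fact, no instance). In the
geometric side of the trace formula for `GL₂` the rational elements `γ ∈ GL₂(F)` split into the
central ones, the **elliptic regular** ones (irreducible characteristic polynomial; treated in
`GL2EllipticTorus`, `GL2EllipticCompactSupport`) and the **parabolic** ones: non-central with
reducible characteristic polynomial. This file proves the algebra behind Gelbart's rearrangement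
(9.36)–(9.38) of the parabolic part as a sum over `B_F \ G_F`:

* `GL2.exists_eigenvector_of_not_irreducible_charpoly` — a reducible (monic quadratic)
  characteristic polynomial has a root `λ ∈ F` (Mathlib
  `Polynomial.Monic.irreducible_iff_roots_eq_zero_of_degree_le_three`), hence `γ` has an
  eigenvector: `γ v = λ v`, `v ≠ 0`;
* `GL2.exists_conj_apply_one_zero_eq_zero_of_not_irreducible_charpoly` — **every `γ ∈ GL₂(F)` with
  reducible characteristic polynomial is `GL₂(F)`-conjugate into the upper triangular Borel
  subgroup `B(F)`** (complete an eigenvector to a basis), i.e. stabilises a line of `F²`.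
* `GL2.mem_borel_iff` (`B = standardParabolicGL F id`: `g ∈ B ↔ g₁₀ = 0`); the **Bruhat
  decomposition of `GL₂(F)`** with the representatives `r(x) = !![x, 1; 1, 0]`, `x ∈ F`, of the
  cosets `g B ≠ B`: `GL2.exists_bruhatRep_inv_mul_mem_borel` (existence, `x = g₀₀/g₁₀`),
  `GL2.eq_of_bruhatRep_inv_mul_bruhatRep_mem_borel` (uniqueness), `GL2.coe_bruhatRep_inv`,
  `GL2.bruhatRep_not_mem_borel`, `GL2.mk_bruhatRep_ne_mk_one` — so `G ⧸ B = {B} ⊔ {r(x) B : x ∈ F}`,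
  the projective line.
* `GL2.bruhatRep_inv_mul_mul_bruhatRep_apply_one_zero` — for `β ∈ B` with entries `a, b, d`, the
  lower-left entry of `r(x)⁻¹ β r(x)` is `b + x (a - d)`; `GL2.mem_center_iff_of_mem_borel` —
  `B ∩ Z(GL₂(F))` are the scalars.
* `GL2.inv_mul_mul_mem_borel_iff_of_mk_eq`, `GL2.setOf_stableCoset_eq_of_mem_borel` — **the cosets
  `g B` with `g⁻¹ β g ∈ B` (the lines of `F²` stable under `β`) for a non-central `β ∈ B` are `B`
  alone when `a = d` (non-semisimple `β`), and `B`, `r(b/(d - a)) B` — two distinct cosets — when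
  `a ≠ d` (hyperbolic regular `β`).** This is the source of the factor `½` in Gelbart's (9.36):
  a hyperbolic regular element lies in exactly two Borel subgroups over `F`, a non-semisimple
  non-central one in exactly one; the rearrangement of `Σ_{γ parabolic}` as a weighted sum over
  `B_F \ G_F` ((9.36)–(9.38)) follows by double counting (not carried out in this file).

## References

* S. Gelbart, *Automorphic forms on adele groups*, Ann. of Math. Studies 83 (1975), (9.36)–(9.39)
  [Gelbart1975].
* H. Jacquet, R. P. Langlands, *Automorphic forms on `GL(2)`*, LNM 114 (1970), §16
  [JacquetLanglands1970].
-/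

noncomputable section

open Polynomial Matrix
open scoped MatrixGroups ENNReal

namespace Literature.NumberTheory.Automorphic

variable {F : Type*} [Field F]

/-- **A `2 × 2` matrix with reducible characteristic polynomial has an eigenvector**: the monic
quadratic `χ_γ` has a root `λ ∈ F`, `det(λ - γ) = χ_γ(λ) = 0`, so `γ v = λ v` for some `v ≠ 0`.
[folklore] -/
theorem GL2.exists_eigenvector_of_not_irreducible_charpoly (γ : Matrix (Fin 2) (Fin 2) F)
    (h : ¬ Irreducible γ.charpoly) :
    ∃ (c : F) (v : Fin 2 → F), v ≠ 0 ∧ γ *ᵥ v = c • v := by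
  have hmonic : γ.charpoly.Monic := Matrix.charpoly_monic γ
  have hdeg : γ.charpoly.natDegree = 2 := by
    rw [Matrix.charpoly_natDegree_eq_dim]; simp
  have hroots : γ.charpoly.roots ≠ 0 := fun hr =>
    h ((hmonic.irreducible_iff_roots_eq_zero_of_degree_le_three (by omega) (by omega)).2 hr)
  obtain ⟨c, hc⟩ := Multiset.exists_mem_of_ne_zero hroots
  rw [Polynomial.mem_roots hmonic.ne_zero, Polynomial.IsRoot.def, Matrix.eval_charpoly] at hc
  obtain ⟨v, hv0, hv⟩ := Matrix.exists_mulVec_eq_zero_iff.2 hc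
  refine ⟨c, v, hv0, ?_⟩
  rw [Matrix.sub_mulVec, sub_eq_zero] at hv
  rw [← hv]
  funext i
  rw [Matrix.scalar_apply, Matrix.mulVec_diagonal, Pi.smul_apply, smul_eq_mul]

/-- **An element of `GL₂(F)` with reducible characteristic polynomial is conjugate into `B(F)`**
(Gelbart (1975), p. 126: the non-elliptic elements of `G_ℚ ∖ Z_ℚ` are the conjugates of elements of
`B_ℚ`): there is `δ ∈ GL₂(F)` with `(δ γ δ⁻¹)₁₀ = 0`. Proof: complete an eigenvector `v` of `γ` to a
basis `P = [v | w]`; then `P⁻¹ γ P` has first column `(λ, 0)`. [cite: Gelbart1975, (9.36)–(9.39)] -/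
theorem GL2.exists_conj_apply_one_zero_eq_zero_of_not_irreducible_charpoly (γ : GL (Fin 2) F)
    (h : ¬ Irreducible (Matrix.charpoly (γ : Matrix (Fin 2) (Fin 2) F))) :
    ∃ δ : GL (Fin 2) F, ((δ * γ * δ⁻¹ : GL (Fin 2) F) : Matrix (Fin 2) (Fin 2) F) 1 0 = 0 := by
  obtain ⟨c, v, hv0, hv⟩ := GL2.exists_eigenvector_of_not_irreducible_charpoly (γ : Matrix (Fin 2) (Fin 2) F) h
  -- a matrix `P` with first column `v` and non-zero determinant
  obtain ⟨P, hP, hPcol⟩ : ∃ P : Matrix (Fin 2) (Fin 2) F, P.det ≠ 0 ∧ ∀ i, P i 0 = v i := by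
    by_cases h0 : v 0 = 0
    · have h1 : v 1 ≠ 0 := by
        intro h1; apply hv0; funext i; fin_cases i <;> assumption
      refine ⟨!![v 0, 1; v 1, 0], ?_, fun i => by fin_cases i <;> rfl⟩
      rw [Matrix.det_fin_two_of]; simpa using h1
    · refine ⟨!![v 0, 0; v 1, 1], ?_, fun i => by fin_cases i <;> rfl⟩
      rw [Matrix.det_fin_two_of]; simpa using h0
  set Q : GL (Fin 2) F := Matrix.GeneralLinearGroup.mkOfDetNeZero P hP with hQ
  have hQval : (Q : Matrix (Fin 2) (Fin 2) F) = P := rfl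
  refine ⟨Q⁻¹, ?_⟩
  rw [inv_inv]
  -- `P e₀ = v`, `P⁻¹ v = e₀`
  have hPe : P *ᵥ Pi.single 0 1 = v := by
    funext i; rw [Matrix.mulVec_single_one]; exact hPcol i
  have hQinv : ((Q⁻¹ : GL (Fin 2) F) : Matrix (Fin 2) (Fin 2) F) * P = 1 := by
    rw [← hQval, ← Units.val_mul, inv_mul_cancel, Units.val_one]
  have hQv : ((Q⁻¹ : GL (Fin 2) F) : Matrix (Fin 2) (Fin 2) F) *ᵥ v = Pi.single 0 1 := by
    rw [← hPe, Matrix.mulVec_mulVec, hQinv, Matrix.one_mulVec]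
  -- the `(1, 0)` entry is the second coordinate of the first column
  have hcol : ((Q⁻¹ * γ * Q : GL (Fin 2) F) : Matrix (Fin 2) (Fin 2) F) 1 0 =
      (((Q⁻¹ * γ * Q : GL (Fin 2) F) : Matrix (Fin 2) (Fin 2) F) *ᵥ Pi.single 0 1) 1 := by
    rw [Matrix.mulVec_single_one]; rfl
  rw [hcol, Units.val_mul, Units.val_mul, hQval, ← Matrix.mulVec_mulVec, ← Matrix.mulVec_mulVec, hPe,
    hv, Matrix.mulVec_smul, hQv]
  simp


/-! ### The Borel subgroup `B(F)` of `GL₂(F)` and the Bruhat decomposition `G = B ⊔ ⨆ₓ r(x) B` -/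

section Bruhat

/-- Membership in the upper triangular Borel subgroup `B(F) = P_{id} ≤ GL₂(F)`
(`standardParabolicGL F id`): `g ∈ B ↔ g₁₀ = 0`. [folklore] -/
theorem GL2.mem_borel_iff (g : GL (Fin 2) F) :
    g ∈ standardParabolicGL F (id : Fin 2 → Fin 2) ↔ (g : Matrix (Fin 2) (Fin 2) F) 1 0 = 0 := by
  rw [mem_standardParabolicGL_iff]
  constructor
  · intro h; exact h (show (id 0 : Fin 2) < id 1 by decide)
  · intro h i j hij
    fin_cases i <;> fin_cases j <;> simp at hij
    exact h

/-- The Bruhat representatives `r(x) = !![x, 1; 1, 0]` have determinant `-1 ≠ 0`. [folklore] -/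
theorem GL2.det_bruhatRep_ne_zero (x : F) : Matrix.det !![x, 1; 1, 0] ≠ 0 := by
  rw [Matrix.det_fin_two_of]; simp

/-- The Bruhat representatives are not in `B`: `r(x)₁₀ = 1`. [folklore] -/
theorem GL2.bruhatRep_not_mem_borel (x : F) :
    Matrix.GeneralLinearGroup.mkOfDetNeZero !![x, 1; 1, 0] (GL2.det_bruhatRep_ne_zero x) ∉
      standardParabolicGL F (id : Fin 2 → Fin 2) := by
  rw [GL2.mem_borel_iff]
  change (!![x, 1; 1, 0] : Matrix (Fin 2) (Fin 2) F) 1 0 ≠ 0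
  simp

/-- The inverse of `r(x)` is `!![0, 1; 1, -x]`. [folklore] -/
theorem GL2.coe_bruhatRep_inv (x : F) :
    (((Matrix.GeneralLinearGroup.mkOfDetNeZero !![x, 1; 1, 0] (GL2.det_bruhatRep_ne_zero x))⁻¹ :
      GL (Fin 2) F) : Matrix (Fin 2) (Fin 2) F) = !![0, 1; 1, -x] := by
  have h : (!![x, 1; 1, 0] : Matrix (Fin 2) (Fin 2) F) * !![0, 1; 1, -x] = 1 := by
    ext i j; fin_cases i <;> fin_cases j <;> simp [Matrix.mul_apply, Fin.sum_univ_two]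
  have h2 : ((Matrix.GeneralLinearGroup.mkOfDetNeZero !![x, 1; 1, 0] (GL2.det_bruhatRep_ne_zero x))⁻¹ :
      GL (Fin 2) F) = ⟨!![0, 1; 1, -x], !![x, 1; 1, 0], by
        ext i j; fin_cases i <;> fin_cases j <;> simp [Matrix.mul_apply, Fin.sum_univ_two], h⟩ :=
    inv_eq_of_mul_eq_one_right (Units.ext h)
  rw [h2]

/-- **Bruhat decomposition of `GL₂(F)`, existence**: every `g ∉ B` lies in a coset `r(x) B`,
`r(x) = !![x, 1; 1, 0]`, namely `x = g₀₀ / g₁₀`. [folklore] -/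
theorem GL2.exists_bruhatRep_inv_mul_mem_borel (g : GL (Fin 2) F)
    (hg : g ∉ standardParabolicGL F (id : Fin 2 → Fin 2)) :
    ∃ x : F, (Matrix.GeneralLinearGroup.mkOfDetNeZero !![x, 1; 1, 0]
      (GL2.det_bruhatRep_ne_zero x))⁻¹ * g ∈ standardParabolicGL F (id : Fin 2 → Fin 2) := by
  rw [GL2.mem_borel_iff] at hg
  refine ⟨(g : Matrix (Fin 2) (Fin 2) F) 0 0 / (g : Matrix (Fin 2) (Fin 2) F) 1 0, ?_⟩
  rw [GL2.mem_borel_iff, Units.val_mul, GL2.coe_bruhatRep_inv]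
  simp [Matrix.mul_apply, Fin.sum_univ_two]
  field_simp
  ring

/-- **Bruhat decomposition, uniqueness**: `r(x) B = r(y) B` only for `x = y`
(`r(x)⁻¹ r(y) = !![1, 0; y - x, 1]`). [folklore] -/
theorem GL2.eq_of_bruhatRep_inv_mul_bruhatRep_mem_borel {x y : F}
    (h : (Matrix.GeneralLinearGroup.mkOfDetNeZero !![x, 1; 1, 0] (GL2.det_bruhatRep_ne_zero x))⁻¹ *
      Matrix.GeneralLinearGroup.mkOfDetNeZero !![y, 1; 1, 0] (GL2.det_bruhatRep_ne_zero y) ∈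
        standardParabolicGL F (id : Fin 2 → Fin 2)) : x = y := by
  rw [GL2.mem_borel_iff, Units.val_mul, GL2.coe_bruhatRep_inv] at h
  change ((!![0, 1; 1, -x] : Matrix (Fin 2) (Fin 2) F) * !![y, 1; 1, 0]) 1 0 = 0 at h
  simp [Matrix.mul_apply, Fin.sum_univ_two] at h
  linear_combination -h

/-- **Conjugating a Borel element by `r(x)`**: for `β ∈ B` with entries `a = β₀₀`, `b = β₀₁`,
`d = β₁₁`, the lower-left entry of `r(x)⁻¹ β r(x)` is `b + x (a - d)`. [folklore] -/
theorem GL2.bruhatRep_inv_mul_mul_bruhatRep_apply_one_zero (β : GL (Fin 2) F)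
    (hβ : β ∈ standardParabolicGL F (id : Fin 2 → Fin 2)) (x : F) :
    (((Matrix.GeneralLinearGroup.mkOfDetNeZero !![x, 1; 1, 0] (GL2.det_bruhatRep_ne_zero x))⁻¹ *
        β * Matrix.GeneralLinearGroup.mkOfDetNeZero !![x, 1; 1, 0] (GL2.det_bruhatRep_ne_zero x) :
          GL (Fin 2) F) : Matrix (Fin 2) (Fin 2) F) 1 0 =
      (β : Matrix (Fin 2) (Fin 2) F) 0 1 +
        x * ((β : Matrix (Fin 2) (Fin 2) F) 0 0 - (β : Matrix (Fin 2) (Fin 2) F) 1 1) := by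
  rw [GL2.mem_borel_iff] at hβ
  rw [Units.val_mul, Units.val_mul, GL2.coe_bruhatRep_inv]
  change ((!![0, 1; 1, -x] : Matrix (Fin 2) (Fin 2) F) * (β : Matrix (Fin 2) (Fin 2) F) *
    !![x, 1; 1, 0]) 1 0 = _
  simp only [Matrix.mul_apply, Fin.sum_univ_two]
  simp [hβ]
  ring

/-- A Borel element is central in `GL₂(F)` iff it is scalar: `β₀₀ = β₁₁` and `β₀₁ = 0`.
[folklore] -/
theorem GL2.mem_center_iff_of_mem_borel (β : GL (Fin 2) F)
    (hβ : β ∈ standardParabolicGL F (id : Fin 2 → Fin 2)) :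
    β ∈ Subgroup.center (GL (Fin 2) F) ↔
      (β : Matrix (Fin 2) (Fin 2) F) 0 0 = (β : Matrix (Fin 2) (Fin 2) F) 1 1 ∧
        (β : Matrix (Fin 2) (Fin 2) F) 0 1 = 0 := by
  rw [GL2.mem_borel_iff] at hβ
  constructor
  · intro hc
    -- commute with `r(0) = w`
    have h1 := Subgroup.mem_center_iff.1 hc
      (Matrix.GeneralLinearGroup.mkOfDetNeZero !![(0 : F), 1; 1, 0] (GL2.det_bruhatRep_ne_zero 0))
    have h1' := congrArg (fun g : GL (Fin 2) F => (g : Matrix (Fin 2) (Fin 2) F)) h1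
    simp only [Units.val_mul] at h1'
    change (!![(0 : F), 1; 1, 0] : Matrix (Fin 2) (Fin 2) F) * (β : Matrix (Fin 2) (Fin 2) F) =
      (β : Matrix (Fin 2) (Fin 2) F) * !![(0 : F), 1; 1, 0] at h1'
    have e00 := congrFun (congrFun h1' 0) 0
    have e01 := congrFun (congrFun h1' 0) 1
    simp only [Matrix.mul_apply, Fin.sum_univ_two] at e00 e01
    simp [hβ] at e00 e01
    exact ⟨e01.symm, e00.symm⟩
  · rintro ⟨had, hb⟩
    -- `β` is the scalar `a`
    have hβeq : (β : Matrix (Fin 2) (Fin 2) F) = (β : Matrix (Fin 2) (Fin 2) F) 0 0 • (1 : Matrix (Fin 2) (Fin 2) F) := by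
      ext i j; fin_cases i <;> fin_cases j <;> simp [hβ, hb, had]
    rw [Subgroup.mem_center_iff]
    intro g
    apply Units.ext
    rw [Units.val_mul, Units.val_mul, hβeq, Matrix.mul_smul, Matrix.smul_mul, Matrix.mul_one,
      Matrix.one_mul]

end Bruhat

/-! ### The cosets `g B` with `g⁻¹ γ g ∈ B` (the lines stable under `γ`) -/

section StableCosets

variable [DecidableEq F]

omit [DecidableEq F] in
/-- **Well-definedness**: the condition `g⁻¹ γ g ∈ B` depends only on the coset `g B`.
[folklore] -/
theorem GL2.inv_mul_mul_mem_borel_iff_of_mk_eq {γ g g' : GL (Fin 2) F}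
    (h : (QuotientGroup.mk g : GL (Fin 2) F ⧸ standardParabolicGL F (id : Fin 2 → Fin 2)) =
      QuotientGroup.mk g') :
    g⁻¹ * γ * g ∈ standardParabolicGL F (id : Fin 2 → Fin 2) ↔
      g'⁻¹ * γ * g' ∈ standardParabolicGL F (id : Fin 2 → Fin 2) := by
  obtain ⟨b, hb⟩ : ∃ b ∈ standardParabolicGL F (id : Fin 2 → Fin 2), g' = g * b :=
    ⟨g⁻¹ * g', QuotientGroup.eq.1 h, by group⟩
  obtain ⟨hbB, rfl⟩ := hb
  have e : (g * b)⁻¹ * γ * (g * b) = b⁻¹ * (g⁻¹ * γ * g) * b := by group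
  rw [e]
  constructor
  · intro hm; exact Subgroup.mul_mem _ (Subgroup.mul_mem _ (Subgroup.inv_mem _ hbB) hm) hbB
  · intro hm
    have := Subgroup.mul_mem _ (Subgroup.mul_mem _ hbB hm) (Subgroup.inv_mem _ hbB)
    rwa [show b * (b⁻¹ * (g⁻¹ * γ * g) * b) * b⁻¹ = g⁻¹ * γ * g by group] at this

/-- **The stable cosets of a non-central Borel element** (the heart of Gelbart's `½`): for
`β ∈ B ∖ Z` with `a = β₀₀`, `b = β₀₁`, `d = β₁₁`, the cosets `g B` with `g⁻¹ β g ∈ B` are `B`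
itself and the `r(x) B` with `b + x(a - d) = 0` — so **exactly two** when `a ≠ d` (hyperbolic
regular: `x = b/(d - a)`) and **exactly one** when `a = d` (then `b ≠ 0`: non-semisimple).
[cite: Gelbart1975, (9.36)–(9.38)] -/
theorem GL2.setOf_stableCoset_eq_of_mem_borel (β : GL (Fin 2) F)
    (hβ : β ∈ standardParabolicGL F (id : Fin 2 → Fin 2))
    (hβc : β ∉ Subgroup.center (GL (Fin 2) F)) :
    {q : GL (Fin 2) F ⧸ standardParabolicGL F (id : Fin 2 → Fin 2) |
        ∃ g, QuotientGroup.mk g = q ∧ g⁻¹ * β * g ∈ standardParabolicGL F (id : Fin 2 → Fin 2)} =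
      if (β : Matrix (Fin 2) (Fin 2) F) 0 0 = (β : Matrix (Fin 2) (Fin 2) F) 1 1 then
        {QuotientGroup.mk (1 : GL (Fin 2) F)}
      else {QuotientGroup.mk (1 : GL (Fin 2) F), QuotientGroup.mk (Matrix.GeneralLinearGroup.mkOfDetNeZero
        !![(β : Matrix (Fin 2) (Fin 2) F) 0 1 /
            ((β : Matrix (Fin 2) (Fin 2) F) 1 1 - (β : Matrix (Fin 2) (Fin 2) F) 0 0), 1; 1, 0]
        (GL2.det_bruhatRep_ne_zero _))} := by
  set a := (β : Matrix (Fin 2) (Fin 2) F) 0 0 with ha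
  set b := (β : Matrix (Fin 2) (Fin 2) F) 0 1 with hb
  set d := (β : Matrix (Fin 2) (Fin 2) F) 1 1 with hd
  -- the condition on a general coset, via Bruhat
  have key : ∀ g : GL (Fin 2) F, g⁻¹ * β * g ∈ standardParabolicGL F (id : Fin 2 → Fin 2) ↔
      (QuotientGroup.mk g : GL (Fin 2) F ⧸ standardParabolicGL F (id : Fin 2 → Fin 2)) =
          QuotientGroup.mk 1 ∨
        ∃ x : F, b + x * (a - d) = 0 ∧
          (QuotientGroup.mk g : GL (Fin 2) F ⧸ standardParabolicGL F (id : Fin 2 → Fin 2)) =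
            QuotientGroup.mk (Matrix.GeneralLinearGroup.mkOfDetNeZero !![x, 1; 1, 0]
              (GL2.det_bruhatRep_ne_zero x)) := by
    intro g
    by_cases hg : g ∈ standardParabolicGL F (id : Fin 2 → Fin 2)
    · have hmk : (QuotientGroup.mk g : GL (Fin 2) F ⧸ standardParabolicGL F (id : Fin 2 → Fin 2)) =
          QuotientGroup.mk 1 := by
        rw [QuotientGroup.eq]; simpa using hg
      refine ⟨fun _ => Or.inl hmk, fun _ => ?_⟩
      exact Subgroup.mul_mem _ (Subgroup.mul_mem _ (Subgroup.inv_mem _ hg) hβ) hg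
    · obtain ⟨x, hx⟩ := GL2.exists_bruhatRep_inv_mul_mem_borel g hg
      have hmk : (QuotientGroup.mk g : GL (Fin 2) F ⧸ standardParabolicGL F (id : Fin 2 → Fin 2)) =
          QuotientGroup.mk (Matrix.GeneralLinearGroup.mkOfDetNeZero !![x, 1; 1, 0]
            (GL2.det_bruhatRep_ne_zero x)) := by
        rw [QuotientGroup.eq]
        have := Subgroup.inv_mem _ hx
        rwa [_root_.mul_inv_rev, inv_inv] at this
      have hne : (QuotientGroup.mk g : GL (Fin 2) F ⧸ standardParabolicGL F (id : Fin 2 → Fin 2)) ≠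
          QuotientGroup.mk 1 := by
        rw [Ne, QuotientGroup.eq, mul_one]
        exact fun h => hg (by simpa using Subgroup.inv_mem _ h)
      rw [GL2.inv_mul_mul_mem_borel_iff_of_mk_eq hmk, GL2.mem_borel_iff,
        GL2.bruhatRep_inv_mul_mul_bruhatRep_apply_one_zero β hβ x]
      constructor
      · intro h0; exact Or.inr ⟨x, h0, hmk⟩
      · rintro (h1 | ⟨y, hy, hmk'⟩)
        · exact absurd h1 hne
        · have hxy : x = y := by
            rw [hmk] at hmk'
            exact GL2.eq_of_bruhatRep_inv_mul_bruhatRep_mem_borel (QuotientGroup.eq.1 hmk')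
          subst hxy; exact hy
  have hscal := GL2.mem_center_iff_of_mem_borel β hβ
  ext q
  simp only [Set.mem_setOf_eq]
  constructor
  · rintro ⟨g, rfl, hg⟩
    rcases (key g).1 hg with h1 | ⟨x, hx, hmk⟩
    · split_ifs <;> simp [h1]
    · split_ifs with had
      · -- `a = d` forces `b = 0`, contradicting non-centrality
        exfalso
        have hb0 : b = 0 := by rw [had, sub_self, mul_zero, add_zero] at hx; exact hx
        exact hβc (hscal.2 ⟨had, hb0⟩)
      · have hxv : x = b / (d - a) := by
          rw [eq_div_iff (sub_ne_zero.2 (Ne.symm had))]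
          linear_combination (-1 : F) * hx
        subst hxv
        simp [hmk]
  · intro hq
    split_ifs at hq with had
    · rw [Set.mem_singleton_iff] at hq
      subst hq
      exact ⟨1, rfl, by simpa using hβ⟩
    · rcases hq with rfl | rfl
      · exact ⟨1, rfl, by simpa using hβ⟩
      · refine ⟨_, rfl, (key _).2 (Or.inr ⟨b / (d - a), ?_, rfl⟩)⟩
        have hne : d - a ≠ 0 := sub_ne_zero.2 (Ne.symm had)
        field_simp
        ring

omit [DecidableEq F] in
/-- The two cosets of the hyperbolic case are distinct (`r(x) ∉ B`). [folklore] -/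
theorem GL2.mk_bruhatRep_ne_mk_one (x : F) :
    (QuotientGroup.mk (Matrix.GeneralLinearGroup.mkOfDetNeZero !![x, 1; 1, 0]
      (GL2.det_bruhatRep_ne_zero x)) : GL (Fin 2) F ⧸ standardParabolicGL F (id : Fin 2 → Fin 2)) ≠
      QuotientGroup.mk 1 := by
  rw [Ne, QuotientGroup.eq, mul_one]
  intro h
  exact GL2.bruhatRep_not_mem_borel x (by simpa using Subgroup.inv_mem _ h)

end StableCosets


/-! ### Transport to an arbitrary parabolic element, and the count of stable cosets -/

section Count

variable [DecidableEq F]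

omit [DecidableEq F] in
/-- The characteristic polynomial of a Borel element is `(X - a)(X - d)`, not irreducible.
[folklore] -/
theorem GL2.not_irreducible_charpoly_of_mem_borel {β : GL (Fin 2) F}
    (hβ : β ∈ standardParabolicGL F (id : Fin 2 → Fin 2)) :
    ¬ Irreducible (Matrix.charpoly (β : Matrix (Fin 2) (Fin 2) F)) := by
  intro h
  rw [Matrix.charpoly_of_upperTriangular _ hβ, Fin.prod_univ_two] at h
  rcases h.isUnit_or_isUnit rfl with hu | hu
  · exact Polynomial.not_isUnit_X_sub_C _ hu
  · exact Polynomial.not_isUnit_X_sub_C _ hu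

omit [DecidableEq F] in
/-- For a Borel element, `tr(β)² = 4 det(β)` iff its diagonal entries coincide
(`(a + d)² - 4 a d = (a - d)²`). [folklore] -/
theorem GL2.trace_sq_eq_iff_of_mem_borel {β : GL (Fin 2) F}
    (hβ : β ∈ standardParabolicGL F (id : Fin 2 → Fin 2)) :
    (β : Matrix (Fin 2) (Fin 2) F).trace ^ 2 = 4 * (β : Matrix (Fin 2) (Fin 2) F).det ↔
      (β : Matrix (Fin 2) (Fin 2) F) 0 0 = (β : Matrix (Fin 2) (Fin 2) F) 1 1 := by
  rw [GL2.mem_borel_iff] at hβ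
  rw [Matrix.trace_fin_two, Matrix.det_fin_two, hβ, mul_zero, sub_zero]
  constructor
  · intro h
    have h2 : ((β : Matrix (Fin 2) (Fin 2) F) 0 0 - (β : Matrix (Fin 2) (Fin 2) F) 1 1) ^ 2 = 0 := by
      linear_combination h
    exact sub_eq_zero.1 (pow_eq_zero_iff two_ne_zero |>.1 h2)
  · intro h; rw [h]; ring

omit [DecidableEq F] in
/-- Conjugates of non-central elements are non-central. [folklore] -/
theorem GL2.conj_not_mem_center {γ g : GL (Fin 2) F} (hγ : γ ∉ Subgroup.center (GL (Fin 2) F)) :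
    g⁻¹ * γ * g ∉ Subgroup.center (GL (Fin 2) F) := by
  intro h; apply hγ
  have h2 := (Subgroup.center (GL (Fin 2) F)).mul_mem
    ((Subgroup.center (GL (Fin 2) F)).mul_mem (Subgroup.mem_center_iff.2 fun x => by group : g * g⁻¹ ∈ _) h)
    (Subgroup.mem_center_iff.2 fun x => by group : g * g⁻¹ ∈ _)
  -- use normality of the centre instead: `g (g⁻¹ γ g) g⁻¹ = γ`
  have hn : (Subgroup.center (GL (Fin 2) F)).Normal := inferInstance
  have := hn.conj_mem _ h g
  rwa [show g * (g⁻¹ * γ * g) * g⁻¹ = γ by group] at this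

omit [DecidableEq F] in
/-- **The stable cosets of a conjugate**: if `β = g₀⁻¹ γ g₀` then
`{g B : g⁻¹ γ g ∈ B} = g₀ • {g B : g⁻¹ β g ∈ B}` (left translation on `G ⧸ B`). [folklore] -/
theorem GL2.setOf_stableCoset_eq_image_smul (γ g₀ : GL (Fin 2) F) :
    {q : GL (Fin 2) F ⧸ standardParabolicGL F (id : Fin 2 → Fin 2) |
        ∃ g, QuotientGroup.mk g = q ∧ g⁻¹ * γ * g ∈ standardParabolicGL F (id : Fin 2 → Fin 2)} =
      (fun q => g₀ • q) '' {q : GL (Fin 2) F ⧸ standardParabolicGL F (id : Fin 2 → Fin 2) |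
        ∃ g, QuotientGroup.mk g = q ∧
          g⁻¹ * (g₀⁻¹ * γ * g₀) * g ∈ standardParabolicGL F (id : Fin 2 → Fin 2)} := by
  ext q
  simp only [Set.mem_setOf_eq, Set.mem_image]
  constructor
  · rintro ⟨g, rfl, hg⟩
    refine ⟨QuotientGroup.mk (g₀⁻¹ * g), ⟨g₀⁻¹ * g, rfl, ?_⟩, ?_⟩
    · rwa [show (g₀⁻¹ * g)⁻¹ * (g₀⁻¹ * γ * g₀) * (g₀⁻¹ * g) = g⁻¹ * γ * g by group]
    · rw [MulAction.Quotient.smul_mk, smul_eq_mul, mul_inv_cancel_left]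
  · rintro ⟨_, ⟨g, rfl, hg⟩, rfl⟩
    refine ⟨g₀ * g, ?_, ?_⟩
    · rw [MulAction.Quotient.smul_mk, smul_eq_mul]
    · rwa [show (g₀ * g)⁻¹ * γ * (g₀ * g) = g⁻¹ * (g₀⁻¹ * γ * g₀) * g by group]

/-- **The number of Borel subgroups over `F` containing a parabolic element**: for `γ ∉ Z` with
reducible characteristic polynomial, the set of cosets `g B` with `g⁻¹ γ g ∈ B` (the `γ`-stable
lines) has `Σ' 1 = 1` element if `tr(γ)² = 4 det(γ)` (one eigenvalue: non-semisimple) and `2` if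
not (two eigenvalues in `F`: hyperbolic regular). [cite: Gelbart1975, (9.36)–(9.38)] -/
theorem GL2.tsum_one_stableCoset (γ : GL (Fin 2) F) (hγc : γ ∉ Subgroup.center (GL (Fin 2) F))
    (hγr : ¬ Irreducible (Matrix.charpoly (γ : Matrix (Fin 2) (Fin 2) F))) :
    ∑' _ : ↥{q : GL (Fin 2) F ⧸ standardParabolicGL F (id : Fin 2 → Fin 2) |
        ∃ g, QuotientGroup.mk g = q ∧ g⁻¹ * γ * g ∈ standardParabolicGL F (id : Fin 2 → Fin 2)},
      (1 : ℝ≥0∞) =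
      if (γ : Matrix (Fin 2) (Fin 2) F).trace ^ 2 = 4 * (γ : Matrix (Fin 2) (Fin 2) F).det then 1
      else 2 := by
  -- conjugate into `B`: `β = g₀⁻¹ γ g₀ ∈ B`
  obtain ⟨δ, hδ⟩ := GL2.exists_conj_apply_one_zero_eq_zero_of_not_irreducible_charpoly γ hγr
  set g₀ : GL (Fin 2) F := δ⁻¹ with hg₀
  set β : GL (Fin 2) F := g₀⁻¹ * γ * g₀ with hβdef
  have hβB : β ∈ standardParabolicGL F (id : Fin 2 → Fin 2) := by
    rw [GL2.mem_borel_iff, hβdef, hg₀, inv_inv]; exact hδ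
  have hβc : β ∉ Subgroup.center (GL (Fin 2) F) := GL2.conj_not_mem_center hγc
  -- trace and determinant are conjugation invariant
  have htr : (β : Matrix (Fin 2) (Fin 2) F).trace = (γ : Matrix (Fin 2) (Fin 2) F).trace := by
    rw [hβdef, Units.val_mul, Units.val_mul]
    exact Matrix.trace_units_conj' g₀ _
  have hdet : (β : Matrix (Fin 2) (Fin 2) F).det = (γ : Matrix (Fin 2) (Fin 2) F).det := by
    rw [hβdef, Units.val_mul, Units.val_mul]
    exact Matrix.det_units_conj' g₀ _
  have hiff : ((γ : Matrix (Fin 2) (Fin 2) F).trace ^ 2 = 4 * (γ : Matrix (Fin 2) (Fin 2) F).det) ↔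
      (β : Matrix (Fin 2) (Fin 2) F) 0 0 = (β : Matrix (Fin 2) (Fin 2) F) 1 1 := by
    rw [← htr, ← hdet]; exact GL2.trace_sq_eq_iff_of_mem_borel hβB
  -- the stable cosets of `γ` are the `g₀`-translates of those of `β`
  have hinj : Function.Injective (fun q : GL (Fin 2) F ⧸ standardParabolicGL F (id : Fin 2 → Fin 2) =>
      g₀ • q) := MulAction.injective g₀
  rw [ENNReal.tsum_set_one, GL2.setOf_stableCoset_eq_image_smul γ g₀, hinj.encard_image,
    GL2.setOf_stableCoset_eq_of_mem_borel β hβB hβc]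
  by_cases had : (β : Matrix (Fin 2) (Fin 2) F) 0 0 = (β : Matrix (Fin 2) (Fin 2) F) 1 1
  · rw [if_pos had, if_pos (hiff.2 had), Set.encard_singleton]; norm_num
  · rw [if_neg had, if_neg (fun h => had (hiff.1 h)),
      Set.encard_pair (GL2.mk_bruhatRep_ne_mk_one (F := F) _).symm]; norm_num

end Count


/-! ### Gelbart's rearrangement (9.36)–(9.38): the parabolic sum as a weighted sum over `G ⧸ B` -/

section DoubleCounting

variable [DecidableEq F]

omit [DecidableEq F] in
/-- The stable cosets through the canonical representatives `q.out`. [folklore] -/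
theorem GL2.setOf_out_stableCoset_eq (γ : GL (Fin 2) F) :
    {q : GL (Fin 2) F ⧸ standardParabolicGL F (id : Fin 2 → Fin 2) |
        q.out⁻¹ * γ * q.out ∈ standardParabolicGL F (id : Fin 2 → Fin 2)} =
      {q | ∃ g, QuotientGroup.mk g = q ∧ g⁻¹ * γ * g ∈ standardParabolicGL F (id : Fin 2 → Fin 2)} := by
  ext q
  constructor
  · intro h; exact ⟨q.out, QuotientGroup.out_eq' q, h⟩
  · rintro ⟨g, hg, h⟩
    rwa [GL2.inv_mul_mul_mem_borel_iff_of_mk_eq (hg.trans (QuotientGroup.out_eq' q).symm)] at h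

omit [DecidableEq F] in
/-- Conjugates `g β g⁻¹` of non-central elements are non-central. [folklore] -/
theorem GL2.conj_not_mem_center' {β g : GL (Fin 2) F} (hβ : β ∉ Subgroup.center (GL (Fin 2) F)) :
    g * β * g⁻¹ ∉ Subgroup.center (GL (Fin 2) F) := by
  simpa using GL2.conj_not_mem_center (g := g⁻¹) hβ

omit [DecidableEq F] in
/-- Conjugates of Borel elements have reducible characteristic polynomial. [folklore] -/
theorem GL2.not_irreducible_charpoly_conj_of_mem_borel {β : GL (Fin 2) F} (g : GL (Fin 2) F)
    (hβ : β ∈ standardParabolicGL F (id : Fin 2 → Fin 2)) :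
    ¬ Irreducible (Matrix.charpoly ((g * β * g⁻¹ : GL (Fin 2) F) : Matrix (Fin 2) (Fin 2) F)) := by
  rw [Units.val_mul, Units.val_mul, Matrix.coe_units_inv, Matrix.charpoly_units_conj]
  exact GL2.not_irreducible_charpoly_of_mem_borel hβ

/-- **The parabolic sum as a weighted sum over `G_F ⧸ B_F`** (Gelbart (1975), (9.36)–(9.38),
p. 126: the hyperbolic regular classes contribute `½ Σ_{μ ∈ A_r} Σ_{δ ∈ A_ℚ \ G_ℚ} f(x⁻¹δ⁻¹μδx) =
½ Σ_{δ ∈ B_ℚ \ G_ℚ} Σ_{μ ∈ A_r} Σ_{ν ∈ N_ℚ} …`, the non-semisimple ones `Σ_{δ ∈ B_ℚ \ G_ℚ} Σ …`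
without the `½`). For every `f : GL₂(F) → [0, ∞]`,

  `Σ'_{γ ∉ Z, χ_γ reducible} f(γ) = Σ'_{q ∈ G ⧸ B} Σ'_{β ∈ B ∖ Z} w(β) · f(q̃ β q̃⁻¹)`,

where `q̃ = q.out` is any representative and `w(β) = 1` if `β₀₀ = β₁₁` (non-semisimple `β`),
`w(β) = ½` if `β₀₀ ≠ β₁₁` (hyperbolic regular `β`): the map `(q, β) ↦ q̃ β q̃⁻¹` hits every
parabolic `γ` exactly once per Borel subgroup containing `γ`, i.e. `1/w` times
(`GL2.tsum_one_stableCoset`). Double counting in `[0, ∞]` (no convergence hypothesis).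
[cite: Gelbart1975, (9.36)–(9.38)] -/
theorem GL2.tsum_parabolic_eq_tsum_quotient_borel (f : GL (Fin 2) F → ℝ≥0∞) :
    ∑' γ : {γ : GL (Fin 2) F // γ ∉ Subgroup.center (GL (Fin 2) F) ∧
        ¬ Irreducible (Matrix.charpoly (γ : Matrix (Fin 2) (Fin 2) F))}, f γ =
      ∑' q : GL (Fin 2) F ⧸ standardParabolicGL F (id : Fin 2 → Fin 2),
        ∑' β : {β : GL (Fin 2) F // β ∈ standardParabolicGL F (id : Fin 2 → Fin 2) ∧
            β ∉ Subgroup.center (GL (Fin 2) F)},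
          (if ((β : GL (Fin 2) F) : Matrix (Fin 2) (Fin 2) F) 0 0 =
              ((β : GL (Fin 2) F) : Matrix (Fin 2) (Fin 2) F) 1 1 then 1 else 2⁻¹) *
            f (q.out * (β : GL (Fin 2) F) * q.out⁻¹) := by
  -- the parametrisation `π (q, β) = q̃ β q̃⁻¹`
  set Par := {γ : GL (Fin 2) F // γ ∉ Subgroup.center (GL (Fin 2) F) ∧
    ¬ Irreducible (Matrix.charpoly (γ : Matrix (Fin 2) (Fin 2) F))} with hPar
  set Bz := {β : GL (Fin 2) F // β ∈ standardParabolicGL F (id : Fin 2 → Fin 2) ∧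
    β ∉ Subgroup.center (GL (Fin 2) F)} with hBz
  set w : GL (Fin 2) F → ℝ≥0∞ := fun β =>
    if (β : Matrix (Fin 2) (Fin 2) F) 0 0 = (β : Matrix (Fin 2) (Fin 2) F) 1 1 then 1 else 2⁻¹ with hw
  set π : (Σ _ : GL (Fin 2) F ⧸ standardParabolicGL F (id : Fin 2 → Fin 2), Bz) → Par := fun t =>
    ⟨t.1.out * (t.2 : GL (Fin 2) F) * t.1.out⁻¹, GL2.conj_not_mem_center' t.2.2.2,
      GL2.not_irreducible_charpoly_conj_of_mem_borel t.1.out t.2.2.1⟩ with hπ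
  -- the right-hand side as a sum over the sigma type, then over the fibres of `π`
  have hR : (∑' q : GL (Fin 2) F ⧸ standardParabolicGL F (id : Fin 2 → Fin 2), ∑' β : Bz,
      w β * f (q.out * (β : GL (Fin 2) F) * q.out⁻¹)) =
      ∑' t : (Σ _ : GL (Fin 2) F ⧸ standardParabolicGL F (id : Fin 2 → Fin 2), Bz),
        w t.2 * f (π t) :=
    (ENNReal.tsum_sigma' (fun t : (Σ _ : GL (Fin 2) F ⧸ standardParabolicGL F (id : Fin 2 → Fin 2),
      Bz) => w t.2 * f (π t))).symm
  change _ = ∑' q : GL (Fin 2) F ⧸ standardParabolicGL F (id : Fin 2 → Fin 2), ∑' β : Bz,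
      w β * f (q.out * (β : GL (Fin 2) F) * q.out⁻¹)
  rw [hR, ← (Equiv.sigmaFiberEquiv π).tsum_eq, ENNReal.tsum_sigma']
  refine tsum_congr fun γ => ?_
  simp only [Equiv.sigmaFiberEquiv_apply]
  -- on the fibre over `γ` the summand is the constant `w_γ f(γ)`
  have hwconst : ∀ t : {t // π t = γ}, w t.1.2 * f (π t.1) =
      (if ((γ : GL (Fin 2) F) : Matrix (Fin 2) (Fin 2) F).trace ^ 2 =
          4 * ((γ : GL (Fin 2) F) : Matrix (Fin 2) (Fin 2) F).det then 1 else 2⁻¹) * f γ := by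
    rintro ⟨t, ht⟩
    have hγt : (γ : GL (Fin 2) F) = t.1.out * (t.2 : GL (Fin 2) F) * t.1.out⁻¹ :=
      (congrArg Subtype.val ht).symm
    have htr : ((γ : GL (Fin 2) F) : Matrix (Fin 2) (Fin 2) F).trace =
        ((t.2 : GL (Fin 2) F) : Matrix (Fin 2) (Fin 2) F).trace := by
      rw [hγt, Units.val_mul, Units.val_mul]; exact Matrix.trace_units_conj _ _
    have hdet : ((γ : GL (Fin 2) F) : Matrix (Fin 2) (Fin 2) F).det =
        ((t.2 : GL (Fin 2) F) : Matrix (Fin 2) (Fin 2) F).det := by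
      rw [hγt, Units.val_mul, Units.val_mul]; exact Matrix.det_units_conj _ _
    have hiff := GL2.trace_sq_eq_iff_of_mem_borel t.2.2.1
    rw [← htr, ← hdet] at hiff
    change w t.2 * f (π t) = _
    rw [ht]
    simp only [hw]
    by_cases h : ((t.2 : GL (Fin 2) F) : Matrix (Fin 2) (Fin 2) F) 0 0 =
        ((t.2 : GL (Fin 2) F) : Matrix (Fin 2) (Fin 2) F) 1 1
    · rw [if_pos h, if_pos (hiff.2 h)]
    · rw [if_neg h, if_neg (fun h' => h (hiff.1 h'))]
  rw [tsum_congr hwconst, ENNReal.tsum_mul_right]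
  -- the fibre is in bijection with the stable cosets of `γ`
  have hfib : (∑' _ : {t // π t = γ}, (1 : ℝ≥0∞)) =
      ∑' _ : ↥{q : GL (Fin 2) F ⧸ standardParabolicGL F (id : Fin 2 → Fin 2) |
        ∃ g, QuotientGroup.mk g = q ∧ g⁻¹ * (γ : GL (Fin 2) F) * g ∈
          standardParabolicGL F (id : Fin 2 → Fin 2)}, (1 : ℝ≥0∞) := by
    rw [← GL2.setOf_out_stableCoset_eq]
    let e : {t // π t = γ} ≃ ↥{q : GL (Fin 2) F ⧸ standardParabolicGL F (id : Fin 2 → Fin 2) |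
        q.out⁻¹ * (γ : GL (Fin 2) F) * q.out ∈ standardParabolicGL F (id : Fin 2 → Fin 2)} :=
      { toFun := fun t => ⟨t.1.1, by
          have hγt : (γ : GL (Fin 2) F) = t.1.1.out * (t.1.2 : GL (Fin 2) F) * t.1.1.out⁻¹ :=
            (congrArg Subtype.val t.2).symm
          change t.1.1.out⁻¹ * (γ : GL (Fin 2) F) * t.1.1.out ∈
            standardParabolicGL F (id : Fin 2 → Fin 2)
          rw [hγt, show t.1.1.out⁻¹ * (t.1.1.out * (t.1.2 : GL (Fin 2) F) * t.1.1.out⁻¹) *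
            t.1.1.out = (t.1.2 : GL (Fin 2) F) by group]
          exact t.1.2.2.1⟩
        invFun := fun s => ⟨⟨s.1, ⟨s.1.out⁻¹ * (γ : GL (Fin 2) F) * s.1.out, s.2,
            GL2.conj_not_mem_center γ.2.1⟩⟩, by
          apply Subtype.ext
          change s.1.out * (s.1.out⁻¹ * (γ : GL (Fin 2) F) * s.1.out) * s.1.out⁻¹ = γ
          group⟩
        left_inv := by
          rintro ⟨⟨q, β, hβ⟩, ht⟩
          have hγt : (γ : GL (Fin 2) F) = q.out * β * q.out⁻¹ := (congrArg Subtype.val ht).symm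
          apply Subtype.ext
          change (⟨q, ⟨q.out⁻¹ * (γ : GL (Fin 2) F) * q.out, _⟩⟩ : Σ _ : GL (Fin 2) F ⧸
            standardParabolicGL F (id : Fin 2 → Fin 2), Bz) = ⟨q, ⟨β, hβ⟩⟩
          congr 2
          rw [hγt]; group
        right_inv := fun s => rfl }
    exact (e.symm.tsum_eq (fun _ => (1 : ℝ≥0∞))).symm
  have hone : (∑' _ : {t // π t = γ},
      (if ((γ : GL (Fin 2) F) : Matrix (Fin 2) (Fin 2) F).trace ^ 2 =
          4 * ((γ : GL (Fin 2) F) : Matrix (Fin 2) (Fin 2) F).det then (1 : ℝ≥0∞) else 2⁻¹)) = 1 := by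
    rw [show (fun _ : {t // π t = γ} =>
        (if ((γ : GL (Fin 2) F) : Matrix (Fin 2) (Fin 2) F).trace ^ 2 =
          4 * ((γ : GL (Fin 2) F) : Matrix (Fin 2) (Fin 2) F).det then (1 : ℝ≥0∞) else 2⁻¹)) =
        fun _ => 1 * (if ((γ : GL (Fin 2) F) : Matrix (Fin 2) (Fin 2) F).trace ^ 2 =
          4 * ((γ : GL (Fin 2) F) : Matrix (Fin 2) (Fin 2) F).det then (1 : ℝ≥0∞) else 2⁻¹)
        from funext fun _ => (one_mul _).symm,
      ENNReal.tsum_mul_right, hfib, GL2.tsum_one_stableCoset (γ : GL (Fin 2) F) γ.2.1 γ.2.2]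
    split_ifs
    · rw [one_mul]
    · exact ENNReal.mul_inv_cancel two_ne_zero ENNReal.ofNat_ne_top
  rw [hone, one_mul]

end DoubleCounting

end Literature.NumberTheory.Automorphic
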